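import Summits.ResolutionOfSingularities.ResolutionOfSingularities.Theorems.DeltaCutStellarLatJLaw
import Summits.ResolutionOfSingularities.ResolutionOfSingularities.Theorems.DeltaCutStellarLatInhabitant

/-!
# StellarCut J21e — «LatJet»: the KERNEL INHABITANT — HAUSER'S OBLIQUE KANGAROO `x² + (1 + xz)z²w²` over `𝔽₂`
# (lens-6 «barrier-complement carving», g36 door 2)

In T19d's model `S = 𝔽₂[x₀, x₁, x₂]_{(x₀,x₁,x₂)}`, `Xs = Spec S`, frame members `D j = (x j)~`, `H = D 0`:

* §Hauser — `fH := x₀² + x₀x₁³x₂² + x₁⁴x₂³ = h² + (h + x₁x₂)·(x₁²x₂)·(x₁x₂)`, `h = x₀`: a LATENT-JET datum for the frame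
  `(V(x₀); x₁ : 2, x₂ : 1)` (terminal labels `hau = (0, 2, 1)`, EVEN on `x₁`) with latent labels `lat = (0, 1, 1)` and the Euler
  derivation `δ = x₂·∂/∂x₂` (`δx₀ = δx₁ = 0`, `δ(x₁²x₂) = x₁²x₂`, `λ = 1`): `ncHypShapeLatJ_hauser`.  `hauser_identity`: substituting
  `x₀ ↦ x₀ + x₁x₂` in Hauser's `x² + (1 + xz)z²w²` (`x = x₀, z = x₁, w = x₂`) gives `fH` — the inhabitant IS the oblique kangaroo of
  [Hauser2010, §5], the named test datum of `WORNCHypWildRest2/3` family (i), in the regular parameters `(x₀ + x₁x₂, x₁, x₂)`.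
* §Law — `weakResolution_hauser`: the datum is resolved BY THE LATENT-JET LAW (J21d), nothing else assumed.
* §NonThin — latent mass `2` (not terminal); `not_ncHypShapeLat_hauser`: with its frame the datum is NOT in L20's latent class for ANY
  latent labelling (the terminal label `2` on `x₁` through the closed point violates the coprime clause); its binomial twin
  `x₀² + (1 + x₀x₁)x₁²x₂²` on T19d's kangaroo frame `(V(x₀); 2, 2)` is a unit-free NC-hypersurface datum with NO jet datum
  (`not_ncHypShapeJet_kangaroo`, T19d, BY NAME) and not latent there either.

0 sorry; axioms standard. [new] [cite: Hauser2010, §5] [cite: Cutkosky2011, §8]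
-/

open CategoryTheory AlgebraicGeometry Literature.AlgebraicGeometry.Resolution IsLocalRing
open Summit.ResolutionOfSingularities.ResolutionOfSingularities.Theorems WeakOrderReduction ForcedTowerClasses

namespace Summit.ResolutionOfSingularities.ResolutionOfSingularities.Theorems.DeltaCutClasses

/-- a derivation times a ring element is a derivation. [folklore] -/
theorem IsDeriv.mul_left {A : Type*} [CommRing A] {δ : A → A} (h : IsDeriv δ) (a : A) : IsDeriv fun s => a * δ s :=
  ⟨fun s t => show a * δ (s + t) = a * δ s + a * δ t by rw [h.map_add]; ring,
    fun s t => show a * δ (s * t) = s * (a * δ t) + t * (a * δ s) by rw [h.leibniz]; ring⟩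

namespace JetModel

/-! ## Hauser's oblique kangaroo `fH = x₀² + x₀x₁³x₂² + x₁⁴x₂³` on the frame `(V(x₀); x₁ : 2, x₂ : 1)`, latent labels `(1, 1)` -/

/-- terminal labels `(0, 2, 1)` on `(D 0, D 1, D 2)` — EVEN on `D 1`. -/
def hau : Fin 3 → ℕ := ![0, 2, 1]

/-- Label of `H = D 0` is `0`. [folklore] -/
@[simp] theorem hau_zero : hau 0 = 0 := rfl
/-- Label of `D 1` is `2`. [folklore] -/
@[simp] theorem hau_one : hau 1 = 2 := rfl
/-- Label of `D 2` is `1`. [folklore] -/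
@[simp] theorem hau_two : hau 2 = 1 := rfl

/-- `fH = x₀² + x₀x₁³x₂² + x₁⁴x₂³`. -/
noncomputable abbrev fH : S := x 0 ^ 2 + x 0 * (x 1 ^ 3 * x 2 ^ 2) + x 1 ^ 4 * x 2 ^ 3

/-- the marked ideal `(fH~, 2)`. -/
noncomputable def MH : MarkedIdeal Xs := ⟨affineBlowup.idealSheaf (Ideal.span {fH}), [], 2⟩

/-- The ideal of Hauser's datum is `(fH)`. [folklore] -/
theorem MH_ideal : MH.ideal = affineBlowup.idealSheaf (Ideal.span {fH}) := rfl

/-- The marking of Hauser's datum is `2`. [folklore] -/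
theorem MH_mult : MH.mult = 2 := rfl

/-- ★ **`fH` IS HAUSER'S OBLIQUE KANGAROO in the regular parameters `(x₀ + x₁x₂, x₁, x₂)`**: substituting `x₀ ↦ x₀ + x₁x₂` in
`x₀² + (1 + x₀x₁)·x₁²x₂²` (= `x² + (1 + xz)z²w²`) gives `fH` (`2 = 0` in `S`). [new] [cite: Hauser2010, §5] -/
theorem hauser_identity : (x 0 + x 1 * x 2) ^ 2 + (1 + (x 0 + x 1 * x 2) * x 1) * (x 1 ^ 2 * x 2 ^ 2) = fH := by
  linear_combination (x 0 * x 1 * x 2 + x 1 ^ 2 * x 2 ^ 2) * two_eq_zero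

/-- The frame monomial of the labels `hau` is `x 1 ^ 2 * x 2`. [folklore] -/
theorem prod_hau : ∏ j, x j ^ hau j = x 1 ^ 2 * x 2 := by
  simp [Fin.prod_univ_three]

/-- The monomial ideal sheaf of `frame hau` is `(x 1 ^ 2 * x 2)`. [folklore] -/
theorem monomialIdeal_hau : monomialIdeal (frame hau) = affineBlowup.idealSheaf (Ideal.span {x 1 ^ 2 * x 2}) := by
  rw [monomialIdeal_frame, prod_hau]

/-- `∂fH/∂x₀ = x₁³x₂²` in `S` (`2 = 0`). [folklore] -/
theorem exists_isDeriv_fH : ∃ δ : S → S, IsDeriv δ ∧ δ fH = x 1 ^ 3 * x 2 ^ 2 := by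
  obtain ⟨δ, hδ, he⟩ := (IsDeriv.of_derivation (MvPolynomial.pderiv (R := ZMod 2) (σ := Fin 3) 0)).exists_extend S
    (originIdeal (ZMod 2) 3).primeCompl
  refine ⟨δ, hδ, ?_⟩
  have hF : fH = algebraMap P S
      (MvPolynomial.X 0 ^ 2 + MvPolynomial.X 0 * (MvPolynomial.X 1 ^ 3 * MvPolynomial.X 2 ^ 2) +
        MvPolynomial.X 1 ^ 4 * MvPolynomial.X 2 ^ 3) := by
    simp only [map_add, map_mul, map_pow]
  have hd : MvPolynomial.pderiv (0 : Fin 3)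
      ((MvPolynomial.X 0 ^ 2 + MvPolynomial.X 0 * (MvPolynomial.X 1 ^ 3 * MvPolynomial.X 2 ^ 2) +
        MvPolynomial.X 1 ^ 4 * MvPolynomial.X 2 ^ 3 : P)) =
      2 * MvPolynomial.X 0 + MvPolynomial.X 1 ^ 3 * MvPolynomial.X 2 ^ 2 := by
    simp only [map_add, Derivation.leibniz, Derivation.leibniz_pow, MvPolynomial.pderiv_X_self,
      MvPolynomial.pderiv_X_of_ne (show (1 : Fin 3) ≠ 0 by decide),
      MvPolynomial.pderiv_X_of_ne (show (2 : Fin 3) ≠ 0 by decide), smul_zero, smul_eq_mul, nsmul_eq_mul,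
      mul_zero, zero_add, add_zero, mul_one]
    push_cast
    ring
  rw [hF, he, hd]
  simp only [map_add, map_mul, map_pow, map_ofNat, two_eq_zero, zero_mul, zero_add]

/-- `∂/∂x₀` on the stalk, with its value on `fH`. [folklore] -/
theorem exists_isDeriv_fH_stalk (p : Xs) :
    ∃ δ : Xs.presheaf.stalk p → Xs.presheaf.stalk p, IsDeriv δ ∧ δ (φ p fH) = φ p (x 1 ^ 3 * x 2 ^ 2) := by
  letI := stalkAlgebra p
  haveI := isLocalizationAtPrime_stalk p
  obtain ⟨δ, hδ, hf⟩ := exists_isDeriv_fH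
  obtain ⟨δ', hδ', he⟩ := hδ.exists_extend (Xs.presheaf.stalk p) p.asIdeal.primeCompl
  exact ⟨δ', hδ', by rw [show φ p fH = algebraMap S _ fH from rfl, he, hf]⟩

/-- **`Supp(fH~, 2) ⊆ V(x₀)`** — via `∂/∂x₀`:
`fH ∈ 𝔪_𝔭²𝒪_𝔭 ⇒ x₁³x₂² ∈ 𝔭 ⇒ x₁x₂ ∈ 𝔭 ⇒ x₀² = fH − x₀x₁³x₂² − x₁⁴x₂³ ∈ 𝔭`. [folklore] -/
theorem support_MH_subset : (MH.support : Set Xs) ⊆ H.support := by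
  intro p hp
  have hle : stalkIdeal MH.ideal p ≤ maximalIdeal _ ^ 2 := (MarkedIdeal.mem_support_iff MH p).mp hp
  rw [MH_ideal, stalkIdeal_span] at hle
  have hf2 : φ p fH ∈ maximalIdeal _ ^ 2 := hle (Ideal.mem_span_singleton_self _)
  have hf1 : fH ∈ p.asIdeal := (mem_maximalIdeal_iff p fH).mp (Ideal.pow_le_self two_ne_zero hf2)
  obtain ⟨δ, hδ, hδf⟩ := exists_isDeriv_fH_stalk p
  have h12 : x 1 ^ 3 * x 2 ^ 2 ∈ p.asIdeal := by
    rw [← mem_maximalIdeal_iff p, ← hδf]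
    exact hδ.apply_mem_of_mem_sq _ hf2
  have h12' : x 1 * x 2 ∈ p.asIdeal := by
    rcases p.2.mem_or_mem h12 with h | h
    · exact p.asIdeal.mul_mem_right _ (p.2.mem_of_pow_mem 3 h)
    · exact p.asIdeal.mul_mem_left _ (p.2.mem_of_pow_mem 2 h)
  have hx0 : x 0 ^ 2 ∈ p.asIdeal := by
    have h1 : x 0 * (x 1 ^ 3 * x 2 ^ 2) ∈ p.asIdeal := by
      have : x 0 * (x 1 ^ 3 * x 2 ^ 2) = x 0 * (x 1 ^ 2 * x 2) * (x 1 * x 2) := by ring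
      rw [this]
      exact p.asIdeal.mul_mem_left _ h12'
    have h2 : x 1 ^ 4 * x 2 ^ 3 ∈ p.asIdeal := by
      have : x 1 ^ 4 * x 2 ^ 3 = x 1 ^ 3 * x 2 ^ 2 * (x 1 * x 2) := by ring
      rw [this]
      exact p.asIdeal.mul_mem_left _ h12'
    have := p.asIdeal.sub_mem (p.asIdeal.sub_mem hf1 h2) h1
    rwa [add_sub_cancel_right, add_sub_cancel_right] at this
  exact (mem_support_D 0 p).mpr (p.2.mem_of_pow_mem 2 hx0)

/-- **THE EULER DERIVATION `x₂·∂/∂x₂` on `S`**: kills `x₀, x₁`, fixes `x₂`, and has the terminal monomial `x₁²x₂` as an eigenvector with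
eigenvalue `1`. [folklore] -/
theorem exists_isDeriv_euler : ∃ δ : S → S, IsDeriv δ ∧ δ (x 0) = 0 ∧ δ (x 1) = 0 ∧ δ (x 2) = x 2 ∧
    δ (x 1 ^ 2 * x 2) = x 1 ^ 2 * x 2 := by
  obtain ⟨δ, hδ, he⟩ := (IsDeriv.of_derivation (MvPolynomial.pderiv (R := ZMod 2) (σ := Fin 3) 2)).exists_extend S
    (originIdeal (ZMod 2) 3).primeCompl
  have hx : ∀ j, δ (x j) = if j = 2 then 1 else 0 := fun j => by
    rw [he, MvPolynomial.pderiv_X]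
    by_cases hj : j = 2
    · subst hj; simp
    · rw [Pi.single_eq_of_ne hj, map_zero, if_neg hj]
  have h0 : δ (x 0) = 0 := by rw [hx]; simp
  have h1 : δ (x 1) = 0 := by rw [hx]; simp
  have h2 : δ (x 2) = 1 := by rw [hx]; simp
  refine ⟨fun s => x 2 * δ s, hδ.mul_left (x 2), by simp only [h0, mul_zero], by simp only [h1, mul_zero],
    by simp only [h2, mul_one], ?_⟩
  show x 2 * δ (x 1 ^ 2 * x 2) = x 1 ^ 2 * x 2
  rw [hδ.leibniz (x 1 ^ 2) (x 2), pow_two, hδ.leibniz (x 1) (x 1), h1, h2]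
  ring

/-- **the Euler derivation on the stalk `𝒪_p`**, with its values on the frame parameters and on `x₁²x₂`. [folklore] -/
theorem exists_isDeriv_euler_stalk (p : Xs) : ∃ δ : Xs.presheaf.stalk p → Xs.presheaf.stalk p, IsDeriv δ ∧
    δ (φ p (x 0)) = 0 ∧ δ (φ p (x 1)) = 0 ∧ δ (φ p (x 2)) = φ p (x 2) ∧ δ (φ p (x 1 ^ 2 * x 2)) = φ p (x 1 ^ 2 * x 2) := by
  letI := stalkAlgebra p
  haveI := isLocalizationAtPrime_stalk p
  obtain ⟨δ, hδ, h0, h1, h2, h12⟩ := exists_isDeriv_euler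
  obtain ⟨δ', hδ', he⟩ := hδ.exists_extend (Xs.presheaf.stalk p) p.asIdeal.primeCompl
  refine ⟨δ', hδ', ?_, ?_, ?_, ?_⟩
  · rw [show φ p (x 0) = algebraMap S _ (x 0) from rfl, he, h0, map_zero]
  · rw [show φ p (x 1) = algebraMap S _ (x 1) from rfl, he, h1, map_zero]
  · rw [show φ p (x 2) = algebraMap S _ (x 2) from rfl, he, h2]
  · rw [show φ p (x 1 ^ 2 * x 2) = algebraMap S _ (x 1 ^ 2 * x 2) from rfl, he, h12]

/-- **the Euler derivation is logarithmic along every frame member through the point** (`δ(x_j) ∈ (x_j)`). [folklore] -/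
theorem euler_log {p : Xs} {δ : Xs.presheaf.stalk p → Xs.presheaf.stalk p} (hδ : IsDeriv δ) (h0 : δ (φ p (x 0)) = 0)
    (h1 : δ (φ p (x 1)) = 0) (h2 : δ (φ p (x 2)) = φ p (x 2)) (a : Fin 3 → ℕ) :
    ∀ K ∈ H :: boundaryOf (frame a), p ∈ K.support → ∀ g ∈ stalkIdeal K p, δ g ∈ stalkIdeal K p := by
  intro K hK _ g hg
  obtain ⟨j, rfl⟩ := (mem_cons_boundaryOf_frame_iff a).mp hK
  rw [stalkIdeal_span] at hg ⊢
  refine hδ.apply_mem_span_singleton_of_log ?_ hg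
  fin_cases j
  · simp only [Fin.zero_eta, h0, Submodule.zero_mem]
  · simp only [Fin.mk_one, h1, Submodule.zero_mem]
  · show δ (φ p (x 2)) ∈ Ideal.span {φ p (x 2)}
    rw [h2]
    exact Ideal.mem_span_singleton_self _

/-- ★ **THE KERNEL INHABITANT OF THE LATENT-JET CLASS.** Hauser's oblique kangaroo `fH = x₀² + (x₀ + x₁x₂)·x₁²x₂·x₁x₂` framed by
`(V(x₀); x₁ : 2, x₂ : 1)` with latent labels `(1, 1)` IS in `ncHypShapeLatJ 2` (`h = x₀`, `m_b = x₁²x₂`, `m_μ = x₁x₂`, `c = −1`, `v = 1`;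
eigen-datum `δ = x₂∂₂`, `λ = 1`: `δ(v c m_b) = −x₁²x₂ = λ·(v c m_b)`). [new] [cite: Hauser2010, §5] -/
theorem ncHypShapeLatJ_hauser : ncHypShapeLatJ 2 Xs (frame hau) (frame lat) H MH := by
  refine ⟨rfl, fun q hq hqH => ?_, fun q hq hqH => ?_, by rw [boundaryOf_frame, boundaryOf_frame], fun y hy => ?_,
    support_MH_subset, Nat.prime_two, two_eq_zero_stalk⟩
  · obtain ⟨j, rfl⟩ := (List.mem_ofFn' _ _).mp hq
    have hj : j = 0 := D_injective hqH
    subst hj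
    exact Or.inl rfl
  · obtain ⟨j, rfl⟩ := (List.mem_ofFn' _ _).mp hq
    have hj : j = 0 := D_injective hqH
    subst hj
    exact Or.inl rfl
  · obtain ⟨δ, hδ, h0, h1, h2, h12⟩ := exists_isDeriv_euler_stalk y
    refine ⟨φ y (x 0), φ y (x 1 ^ 2 * x 2), φ y (x 1 * x 2), -1, 1, δ, 1, isUnit_one.neg, isUnit_one, stalkIdeal_span _ _,
      ?_, ?_, ?_, hδ, euler_log hδ h0 h1 h2 hau, isUnit_one, ?_⟩
    · rw [monomialIdeal_hau, stalkIdeal_span]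
    · rw [monomialIdeal_lat, stalkIdeal_span]
    · rw [MH_ideal, stalkIdeal_span]
      congr 1
      simp only [Set.singleton_eq_singleton_iff, map_add, map_mul, map_pow]
      ring
    · rw [show (1 : Xs.presheaf.stalk y) * -1 * φ y (x 1 ^ 2 * x 2) = -φ y (x 1 ^ 2 * x 2) by ring, hδ.map_neg, h12, one_mul]

/-! ## The law resolves the inhabitant; non-thinness -/

/-- **non-degeneracy**: the closed point is a point of order `2` of `fH`, i.e. `pt ∈ Supp(MH)`. [new] -/
theorem pt_mem_support_MH : pt ∈ MH.support := by
  rw [MarkedIdeal.mem_support_iff, MH_ideal, stalkIdeal_span, MH_mult, Ideal.span_le, Set.singleton_subset_iff,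
    SetLike.mem_coe, maximalIdeal_stalk_eq, pt_asIdeal, ← Ideal.map_pow]
  refine Ideal.mem_map_of_mem _ ?_
  rw [pow_two]
  refine Ideal.add_mem _ (Ideal.add_mem _ (by rw [pow_two]; exact Ideal.mul_mem_mul (x_mem 0) (x_mem 0))
    (Ideal.mul_mem_mul (x_mem 0) (Ideal.mul_mem_left _ _ (Ideal.pow_mem_of_mem _ (x_mem 2) 2 (by norm_num))))) ?_
  rw [show x 1 ^ 4 * x 2 ^ 3 = (x 1 * (x 1 ^ 3 * x 2 ^ 2)) * x 2 by ring]
  exact Ideal.mul_mem_mul (Ideal.mul_mem_right _ _ (x_mem 1)) (x_mem 2)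

/-- **non-degeneracy of Hauser's datum**: s.n.c. frame through `H`, `H` a member, the closed point of order `2`, latent mass `2`
(the law performs TWO latent hops before T19's strategy). [new] -/
theorem hauser_nondegenerate :
    HasSNC (H :: boundaryOf (frame hau)) ∧ H ∈ boundaryOf (frame hau) ∧ pt ∈ MH.support ∧ latMass (frame lat) H = 2 :=
  ⟨hasSNC_frame _, H_mem_boundaryOf_frame _, pt_mem_support_MH, latMass_lat⟩

/-- ★★ **THE LATENT-JET LAW RESOLVES HAUSER'S OBLIQUE KANGAROO**: `(fH~, 2)` admits a weak resolution — from `ncHypShapeLatJ_hauser` and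
the list law `exists_weakResolution_of_ncHypShapeLatJ` (J21d), nothing else. [new] [cite: Hauser2010, §5] -/
theorem weakResolution_hauser : ∃ s : CentreSeq Xs, WeakResolution s MH :=
  ncHypShapeLatJ_hauser.exists_weakResolution (hasSNC_frame hau) (H_mem_boundaryOf_frame hau)

/-- ★ **NOT IN L20's LATENT CLASS with this frame, for ANY latent labelling**: the terminal label of `V(x₁)` (through the closed point) is
`2` — neither `0` nor prime to `2` (L20a's coprime clause fails). [new] -/
theorem not_ncHypShapeLat_hauser (L' : List (Xs.IdealSheafData × ℕ)) : ¬ ncHypShapeLat 2 Xs (frame hau) L' H MH := by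
  intro hP
  rcases hP.labels (K := D 1) (pt_mem_support_D 1) with h | h
  · rw [expOf_frame] at h
    exact absurd h (by decide)
  · rw [expOf_frame] at h
    exact h (by decide)

/-! ## The binomial twin `x₀² + (1 + x₀x₁)x₁²x₂²` on the kangaroo frame `(V(x₀); 2, 2)` -/

/-- `fHK = x₀² + (1 + x₀x₁)·x₁²x₂²` — Hauser's `x² + (1 + xz)z²w²` verbatim (`x₀ = x`, `x₁ = z`, `x₂ = w`). -/
noncomputable abbrev fHK : S := x 0 ^ 2 + (1 + x 0 * x 1) * (x 1 ^ 2 * x 2 ^ 2)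

/-- the marked ideal `(fHK~, 2)`. -/
noncomputable def MHK : MarkedIdeal Xs := ⟨affineBlowup.idealSheaf (Ideal.span {fHK}), [], 2⟩

/-- The ideal of the twin is `(fHK)`. [folklore] -/
theorem MHK_ideal : MHK.ideal = affineBlowup.idealSheaf (Ideal.span {fHK}) := rfl

/-- `∂fHK/∂x₀ = x₁³x₂²` in `S` (`2 = 0`). [folklore] -/
theorem exists_isDeriv_fHK : ∃ δ : S → S, IsDeriv δ ∧ δ fHK = x 1 ^ 3 * x 2 ^ 2 := by
  obtain ⟨δ, hδ, he⟩ := (IsDeriv.of_derivation (MvPolynomial.pderiv (R := ZMod 2) (σ := Fin 3) 0)).exists_extend S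
    (originIdeal (ZMod 2) 3).primeCompl
  refine ⟨δ, hδ, ?_⟩
  have hF : fHK = algebraMap P S
      (MvPolynomial.X 0 ^ 2 + (1 + MvPolynomial.X 0 * MvPolynomial.X 1) * (MvPolynomial.X 1 ^ 2 * MvPolynomial.X 2 ^ 2)) := by
    simp only [map_add, map_mul, map_pow, map_one]
  have hd : MvPolynomial.pderiv (0 : Fin 3)
      ((MvPolynomial.X 0 ^ 2 + (1 + MvPolynomial.X 0 * MvPolynomial.X 1) * (MvPolynomial.X 1 ^ 2 * MvPolynomial.X 2 ^ 2) : P)) =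
      2 * MvPolynomial.X 0 + MvPolynomial.X 1 ^ 3 * MvPolynomial.X 2 ^ 2 := by
    simp only [map_add, Derivation.map_one_eq_zero, Derivation.leibniz, Derivation.leibniz_pow, MvPolynomial.pderiv_X_self,
      MvPolynomial.pderiv_X_of_ne (show (1 : Fin 3) ≠ 0 by decide),
      MvPolynomial.pderiv_X_of_ne (show (2 : Fin 3) ≠ 0 by decide), smul_zero, smul_eq_mul, nsmul_eq_mul,
      mul_zero, zero_add, add_zero, mul_one]
    push_cast
    ring
  rw [hF, he, hd]
  simp only [map_add, map_mul, map_pow, map_ofNat, two_eq_zero, zero_mul, zero_add]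

/-- **`Supp(fHK~, 2) ⊆ V(x₀)`** — via `∂/∂x₀` (`x₁³x₂² ∈ 𝔭 ⇒ x₁x₂ ∈ 𝔭 ⇒ x₀² ∈ 𝔭`). [folklore] -/
theorem support_MHK_subset : (MHK.support : Set Xs) ⊆ H.support := by
  intro p hp
  letI := stalkAlgebra p
  haveI := isLocalizationAtPrime_stalk p
  have hle : stalkIdeal MHK.ideal p ≤ maximalIdeal _ ^ 2 := (MarkedIdeal.mem_support_iff MHK p).mp hp
  rw [MHK_ideal, stalkIdeal_span] at hle
  have hf2 : φ p fHK ∈ maximalIdeal _ ^ 2 := hle (Ideal.mem_span_singleton_self _)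
  have hf1 : fHK ∈ p.asIdeal := (mem_maximalIdeal_iff p fHK).mp (Ideal.pow_le_self two_ne_zero hf2)
  obtain ⟨δ, hδ, hf⟩ := exists_isDeriv_fHK
  obtain ⟨δ', hδ', he⟩ := hδ.exists_extend (Xs.presheaf.stalk p) p.asIdeal.primeCompl
  have h12 : x 1 ^ 3 * x 2 ^ 2 ∈ p.asIdeal := by
    rw [← mem_maximalIdeal_iff p, ← hf, show φ p (δ fHK) = algebraMap S _ (δ fHK) from rfl, ← he]
    exact hδ'.apply_mem_of_mem_sq _ hf2
  have h12' : x 1 * x 2 ∈ p.asIdeal := by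
    rcases p.2.mem_or_mem h12 with h | h
    · exact p.asIdeal.mul_mem_right _ (p.2.mem_of_pow_mem 3 h)
    · exact p.asIdeal.mul_mem_left _ (p.2.mem_of_pow_mem 2 h)
  have hx0 : x 0 ^ 2 ∈ p.asIdeal := by
    have h1 : (1 + x 0 * x 1) * (x 1 ^ 2 * x 2 ^ 2) ∈ p.asIdeal := by
      rw [show (1 + x 0 * x 1) * (x 1 ^ 2 * x 2 ^ 2) = (1 + x 0 * x 1) * (x 1 * x 2) * (x 1 * x 2) by ring]
      exact p.asIdeal.mul_mem_left _ h12'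
    have := p.asIdeal.sub_mem hf1 h1
    rwa [add_sub_cancel_right] at this
  exact (mem_support_D 0 p).mpr (p.2.mem_of_pow_mem 2 hx0)

/-- **THE TWIN IS A BINOMIAL HYPERSURFACE-SHAPE DATUM on the kangaroo frame** `(V(x₀); x₁ : 2, x₂ : 2)`: `fHK = h² + u·m`, `h = x₀`,
`m = x₁²x₂²`, `u = 1 + x₀x₁` a unit (T17a's `ncHypShapeF 2`). [new] -/
theorem ncHypShapeF_hauserTwin : ncHypShapeF 2 Xs (frame kangaroo) H MHK := by
  refine ⟨rfl, fun q hq hqH => ?_, fun y hy => ?_, support_MHK_subset⟩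
  · obtain ⟨j, rfl⟩ := (List.mem_ofFn' _ _).mp hq
    have hj : j = 0 := D_injective hqH
    subst hj
    exact Or.inl rfl
  · have hu : IsUnit (φ y (1 + x 0 * x 1)) := by
      refine (isUnit_iff y _).mpr fun h1 => y.2.ne_top ((Ideal.eq_top_iff_one _).mpr ?_)
      have := y.asIdeal.sub_mem h1 (y.asIdeal.mul_mem_right (x 1) ((mem_support_D 0 y).mp hy))
      rwa [add_sub_cancel_right] at this
    refine ⟨φ y (x 0), φ y (x 1 ^ 2 * x 2 ^ 2), φ y (1 + x 0 * x 1), hu, stalkIdeal_span _ _, ?_, ?_⟩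
    · rw [monomialIdeal_kangaroo, stalkIdeal_span]
    · rw [MHK_ideal, stalkIdeal_span]
      congr 1
      simp only [map_add, map_mul, map_pow, map_one]

/-- **… with NO JET DATUM on that frame** (T19d `not_ncHypShapeJet_kangaroo`, BY NAME). [new] -/
theorem not_ncHypShapeJet_hauserTwin : ¬ ncHypShapeJet 2 Xs (frame kangaroo) H MHK := not_ncHypShapeJet_kangaroo MHK

/-- **… and NOT LATENT there either** (terminal labels `2, 2` even through the closed point: L20a's coprime clause fails for every latent
labelling). [new] -/
theorem not_ncHypShapeLat_hauserTwin (L' : List (Xs.IdealSheafData × ℕ)) : ¬ ncHypShapeLat 2 Xs (frame kangaroo) L' H MHK := by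
  intro hP
  rcases hP.labels (K := D 1) (pt_mem_support_D 1) with h | h
  · rw [expOf_frame] at h
    exact absurd h (by decide)
  · rw [expOf_frame] at h
    exact h (by decide)

end JetModel

end Summit.ResolutionOfSingularities.ResolutionOfSingularities.Theorems.DeltaCutClasses
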